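import Literature.Probability.RandomPlanarGeometry.HexSAWBrickWallStripFugacityWidthOneJointContactLDP
import HarnessLib

/-!
# Gibbs duality for the two-density contact entropy: the supergradient of `s` is minus the log-tilt

Child module of `HexSAWBrickWallStripFugacityWidthOneJointContactLDP.lean` (§8).  The two-density contact entropy `s(a,a')`
(`contactEntropy₂`) of the strip SAW is the concave conjugate of the free energy; this file proves the dual half of the Legendre
picture: at every point `(a,a')` of the open density triangle the vector `(−log Y(a,a'), −log Y(a',a))` — minus the logarithms of the
fugacity pair realising the densities (`eosY`, the inverse equation of state) — is a STRICT SUPERGRADIENT of `s` (§1), and `s` is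
Gâteaux-differentiable with exactly this gradient (§2): `∂s/∂a = −log Y(a,a')`, `∂s/∂a' = −log Y(a',a)` — the thermodynamic identity
"d(entropy)/d(density) = −(log-fugacity)".

## Main statements (namespace `Literature.Probability.RandomPlanarGeometry.SAW.HexBW`, all PROVED, standard axioms)
§1 ★★★ **`contactEntropy₂_superGradient`** (`s(ã,ã') ≤ s(a,a') − (ã−a) log Y(a,a') − (ã'−a') log Y(a',a)` on the triangle, `<` off the point).
§2 ★★ **`hasDerivAt_contactEntropy₂_dir`** (directional derivative `−d₁ log Y(a,a') − d₂ log Y(a',a)` along every direction `(d₁,d₂)`),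
`hasDerivAt_contactEntropy₂_partial`.
§3 (ed.2) ★★ `hasDerivAt_jointRate_eosY_dir` (the joint rate in density coordinates has gradient the LOG-TILT `(log(Y/y), log(Z/z))`),
★★ `jointRate_gradient_eq_zero_iff` (its unique critical point is the typical density pair).

## Sources
JansevanRensburg2000 §3.2 Theorems 3.18–3.19 (1st ed., OUP 2000 = the held text: density function and free energy as a Legendre pair);
DemboZeitouni2010 §2.2 (Cramér duality); BeatonBousquetMelouDeGierDuminilCopinGuttmann2014 §3.2 Proposition 6 (arXiv v5 p. 10; objects).
Nothing quoted AS PRINTED; the statements are this lineage's (the sources treat one density).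
-/

noncomputable section

open Filter Topology Finset Literature.Probability.LatticeModels Literature.Probability.Percolation SimpleGraph

namespace Literature.Probability.RandomPlanarGeometry.SAW.HexBW

open WidthOneYZ

/-! ## §1 The strict supergradient inequality -/

/-- ★★★ **GIBBS DUALITY — THE SUPERGRADIENT OF THE ENTROPY IS MINUS THE LOG-TILT**: for `(a,a')` and `(ã,ã')` in the open density triangle,
`s(ã,ã') ≤ s(a,a') − (ã − a)·log Y(a,a') − (ã' − a')·log Y(a',a)`, with STRICT inequality unless `(ã,ã') = (a,a')`
(the variational inequality `contactEntropy₂_le` at the base `(Y(a,a'), Y(a',a))`, whose density pair is `(a,a')`).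
[cite: JansevanRensburg2000, §3.2 Theorems 3.18–3.19 (1st ed., pp. 51–52); DemboZeitouni2010, §2.2 Theorem 2.2.3] -/
theorem contactEntropy₂_superGradient {a a' ã ã' : ℝ} (h1 : a + a' < 1 / 2) (h2 : 1 < 4 * a + 2 * a') (h3 : 1 < 2 * a + 4 * a')
    (k1 : ã + ã' < 1 / 2) (k2 : 1 < 4 * ã + 2 * ã') (k3 : 1 < 2 * ã + 4 * ã') :
    contactEntropy₂ ã ã' ≤ contactEntropy₂ a a' - (ã - a) * Real.log (eosY a a') - (ã' - a') * Real.log (eosY a' a) ∧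
      ((ã ≠ a ∨ ã' ≠ a') → contactEntropy₂ ã ã' <
        contactEntropy₂ a a' - (ã - a) * Real.log (eosY a a') - (ã' - a') * Real.log (eosY a' a)) := by
  obtain ⟨hY0, hZ0, hb, hb', -, -⟩ := contactB_eosY h1 h2 h3
  obtain ⟨hle, hlt⟩ := contactEntropy₂_le k1 k2 k3 hY0 hZ0
  have hs : contactEntropy₂ a a' = Real.log (stripMuY₂ 1 (eosY a a') (eosY a' a)) - a * Real.log (eosY a a') -
      a' * Real.log (eosY a' a) := rfl
  refine ⟨by rw [hs]; linarith, fun hne => ?_⟩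
  have hne' : eosY a a' ≠ eosY ã ã' ∨ eosY a' a ≠ eosY ã' ã := by
    rcases Classical.em (eosY a a' = eosY ã ã' ∧ eosY a' a = eosY ã' ã) with hcon | hcon
    · exfalso
      obtain ⟨-, -, kb, kb', -, -⟩ := contactB_eosY k1 k2 k3
      rw [← hcon.1, ← hcon.2, hb] at kb
      rw [← hcon.1, ← hcon.2, hb'] at kb'
      rcases hne with h | h
      · exact h kb.symm
      · exact h kb'.symm
    · exact not_and_or.1 hcon
  have := hlt hne'
  rw [hs]; linarith

/-! ## §2 Gâteaux differentiability of the entropy -/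

/-- ★★ **The entropy is differentiable along every line, with gradient `(−log Y(a,a'), −log Y(a',a))`**: for `(a,a')` in the open triangle and
any direction `(d₁,d₂)`, `θ ↦ s(a + θd₁, a' + θd₂)` has derivative `−d₁ log Y(a,a') − d₂ log Y(a',a)` at `θ = 0` (squeeze between the
supergradient inequalities at the two endpoints, `contactEntropy₂_superGradient`, and the continuity of `eosY`).
[cite: JansevanRensburg2000, §3.2 Theorem 3.19 (1st ed., p. 52); DemboZeitouni2010, §2.2 (Cramér duality)] -/
theorem hasDerivAt_contactEntropy₂_dir {a a' : ℝ} (h1 : a + a' < 1 / 2) (h2 : 1 < 4 * a + 2 * a') (h3 : 1 < 2 * a + 4 * a')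
    (d₁ d₂ : ℝ) :
    HasDerivAt (fun θ : ℝ => contactEntropy₂ (a + θ * d₁) (a' + θ * d₂))
      (-(d₁ * Real.log (eosY a a')) - d₂ * Real.log (eosY a' a)) 0 := by
  rw [hasDerivAt_iff_tendsto_slope_zero]
  set D := -(d₁ * Real.log (eosY a a')) - d₂ * Real.log (eosY a' a) with hD
  have ha0 : 0 < a := by linarith
  have ha0' : 0 < a' := by linarith
  -- the moving point stays in the triangle for small `θ`
  have hT : ∀ᶠ θ : ℝ in 𝓝 0, (a + θ * d₁) + (a' + θ * d₂) < 1 / 2 ∧ 1 < 4 * (a + θ * d₁) + 2 * (a' + θ * d₂) ∧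
      1 < 2 * (a + θ * d₁) + 4 * (a' + θ * d₂) := by
    have c1 : ContinuousAt (fun θ : ℝ => (a + θ * d₁) + (a' + θ * d₂)) 0 :=
      (continuousAt_const.add (continuousAt_id.mul continuousAt_const)).add
        (continuousAt_const.add (continuousAt_id.mul continuousAt_const))
    have c2 : ContinuousAt (fun θ : ℝ => 4 * (a + θ * d₁) + 2 * (a' + θ * d₂)) 0 :=
      (continuousAt_const.mul (continuousAt_const.add (continuousAt_id.mul continuousAt_const))).add
        (continuousAt_const.mul (continuousAt_const.add (continuousAt_id.mul continuousAt_const)))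
    have c3 : ContinuousAt (fun θ : ℝ => 2 * (a + θ * d₁) + 4 * (a' + θ * d₂)) 0 :=
      (continuousAt_const.mul (continuousAt_const.add (continuousAt_id.mul continuousAt_const))).add
        (continuousAt_const.mul (continuousAt_const.add (continuousAt_id.mul continuousAt_const)))
    have e1 := c1.eventually_lt continuousAt_const (by simp only [zero_mul, add_zero]; exact h1)
    have e2 := (continuousAt_const).eventually_lt c2 (by simp only [zero_mul, add_zero]; exact h2)
    have e3 := (continuousAt_const).eventually_lt c3 (by simp only [zero_mul, add_zero]; exact h3)
    filter_upwards [e1, e2, e3] with θ t1 t2 t3 using ⟨t1, t2, t3⟩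
  have hf0 : contactEntropy₂ (a + 0 * d₁) (a' + 0 * d₂) = contactEntropy₂ a a' := by simp
  -- upper bound from the supergradient at the base point, lower bound from the supergradient at the moving point
  have hup : ∀ᶠ θ : ℝ in 𝓝 0, contactEntropy₂ (a + θ * d₁) (a' + θ * d₂) - contactEntropy₂ a a' ≤ θ * D := by
    filter_upwards [hT] with θ hθ
    have h := (contactEntropy₂_superGradient h1 h2 h3 hθ.1 hθ.2.1 hθ.2.2).1
    rw [hD]
    have e1 : a + θ * d₁ - a = θ * d₁ := by ring
    have e2 : a' + θ * d₂ - a' = θ * d₂ := by ring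
    rw [e1, e2] at h
    linarith
  have hlow : ∀ᶠ θ : ℝ in 𝓝 0, θ * (-(d₁ * Real.log (eosY (a + θ * d₁) (a' + θ * d₂))) -
      d₂ * Real.log (eosY (a' + θ * d₂) (a + θ * d₁))) ≤
      contactEntropy₂ (a + θ * d₁) (a' + θ * d₂) - contactEntropy₂ a a' := by
    filter_upwards [hT] with θ hθ
    have h := (contactEntropy₂_superGradient hθ.1 hθ.2.1 hθ.2.2 h1 h2 h3).1
    have e1 : a - (a + θ * d₁) = -(θ * d₁) := by ring
    have e2 : a' - (a' + θ * d₂) = -(θ * d₂) := by ring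
    rw [e1, e2] at h
    linarith
  -- continuity of the moving gradient at `θ = 0`
  have hpath : ContinuousAt (fun θ : ℝ => (a + θ * d₁, a' + θ * d₂)) 0 :=
    (continuousAt_const.add (continuousAt_id.mul continuousAt_const)).prodMk
      (continuousAt_const.add (continuousAt_id.mul continuousAt_const))
  have hpath' : ContinuousAt (fun θ : ℝ => (a' + θ * d₂, a + θ * d₁)) 0 :=
    (continuousAt_const.add (continuousAt_id.mul continuousAt_const)).prodMk
      (continuousAt_const.add (continuousAt_id.mul continuousAt_const))
  have h0 : (fun θ : ℝ => (a + θ * d₁, a' + θ * d₂)) 0 = (a, a') := by simp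
  have h0' : (fun θ : ℝ => (a' + θ * d₂, a + θ * d₁)) 0 = (a', a) := by simp
  have h1' : a' + a < 1 / 2 := by linarith
  have hY : ContinuousAt (fun θ : ℝ => eosY (a + θ * d₁) (a' + θ * d₂)) 0 := by
    have h := continuousAt_eosY ha0 h1
    rw [← h0] at h
    exact ContinuousAt.comp (f := fun θ : ℝ => (a + θ * d₁, a' + θ * d₂)) (g := fun p : ℝ × ℝ => eosY p.1 p.2) h hpath
  have hZ : ContinuousAt (fun θ : ℝ => eosY (a' + θ * d₂) (a + θ * d₁)) 0 := by
    have h := continuousAt_eosY ha0' h1'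
    rw [← h0'] at h
    exact ContinuousAt.comp (f := fun θ : ℝ => (a' + θ * d₂, a + θ * d₁)) (g := fun p : ℝ × ℝ => eosY p.1 p.2) h hpath'
  obtain ⟨hY0, hZ0, -, -, -, -⟩ := contactB_eosY h1 h2 h3
  have hlogY : ContinuousAt (fun θ : ℝ => Real.log (eosY (a + θ * d₁) (a' + θ * d₂))) 0 :=
    hY.log (by simp only [zero_mul, add_zero]; exact hY0.ne')
  have hlogZ : ContinuousAt (fun θ : ℝ => Real.log (eosY (a' + θ * d₂) (a + θ * d₁))) 0 :=
    hZ.log (by simp only [zero_mul, add_zero]; exact hZ0.ne')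
  have hG : ContinuousAt (fun θ : ℝ => -(d₁ * Real.log (eosY (a + θ * d₁) (a' + θ * d₂))) -
      d₂ * Real.log (eosY (a' + θ * d₂) (a + θ * d₁))) 0 := (continuousAt_const.mul hlogY).neg.sub (continuousAt_const.mul hlogZ)
  have hGt : Tendsto (fun θ : ℝ => -(d₁ * Real.log (eosY (a + θ * d₁) (a' + θ * d₂))) -
      d₂ * Real.log (eosY (a' + θ * d₂) (a + θ * d₁))) (𝓝[≠] 0) (𝓝 D) := by
    have h := hG.tendsto
    simp only [zero_mul, add_zero] at h
    exact h.mono_left nhdsWithin_le_nhds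
  have hmin := (tendsto_const_nhds (x := D)).min hGt
  have hmax := (tendsto_const_nhds (x := D)).max hGt
  rw [min_self] at hmin
  rw [max_self] at hmax
  have hup' := hup.filter_mono (nhdsWithin_le_nhds (s := ({0}ᶜ : Set ℝ)))
  have hlow' := hlow.filter_mono (nhdsWithin_le_nhds (s := ({0}ᶜ : Set ℝ)))
  refine tendsto_of_tendsto_of_tendsto_of_le_of_le' hmin hmax ?_ ?_
  · filter_upwards [self_mem_nhdsWithin, hup', hlow'] with θ hθ hu hl
    have hθ : θ ≠ 0 := hθ
    rw [zero_add, smul_eq_mul, hf0]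
    rcases lt_or_gt_of_ne hθ with hneg | hpos
    · refine min_le_of_left_le ?_
      rw [← div_eq_inv_mul, le_div_iff_of_neg hneg]
      linarith
    · refine min_le_of_right_le ?_
      rw [← div_eq_inv_mul, le_div_iff₀ hpos]
      linarith
  · filter_upwards [self_mem_nhdsWithin, hup', hlow'] with θ hθ hu hl
    have hθ : θ ≠ 0 := hθ
    rw [zero_add, smul_eq_mul, hf0]
    rcases lt_or_gt_of_ne hθ with hneg | hpos
    · refine le_max_of_le_right ?_
      rw [← div_eq_inv_mul, div_le_iff_of_neg hneg]
      linarith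
    · refine le_max_of_le_left ?_
      rw [← div_eq_inv_mul, div_le_iff₀ hpos]
      linarith

/-- ★★ **Partial derivatives**: `∂s/∂a (a,a') = −log Y(a,a')` and `∂s/∂a' (a,a') = −log Y(a',a)` (directions `(1,0)` and `(0,1)`,
translated from `θ = 0` to the base point). [cite: JansevanRensburg2000, §3.2 Theorem 3.19 (1st ed., p. 52)] -/
theorem hasDerivAt_contactEntropy₂_partial {a a' : ℝ} (h1 : a + a' < 1 / 2) (h2 : 1 < 4 * a + 2 * a') (h3 : 1 < 2 * a + 4 * a') :
    HasDerivAt (fun x : ℝ => contactEntropy₂ x a') (-Real.log (eosY a a')) a ∧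
      HasDerivAt (fun x : ℝ => contactEntropy₂ a x) (-Real.log (eosY a' a)) a' := by
  constructor
  · have h := hasDerivAt_contactEntropy₂_dir h1 h2 h3 1 0
    simp only [mul_one, mul_zero, add_zero, one_mul, zero_mul, sub_zero] at h
    -- `x ↦ s(x, a')` is `θ ↦ s(a + θ, a')` composed with `x ↦ x − a`
    have hsub : HasDerivAt (fun x : ℝ => x - a) 1 a := (hasDerivAt_id a).sub_const a
    have hc := HasDerivAt.comp (h₂ := fun θ : ℝ => contactEntropy₂ (a + θ) a') (h := fun x : ℝ => x - a) a
      (by rw [sub_self]; exact h) hsub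
    rw [mul_one] at hc
    refine hc.congr_of_eventuallyEq (Filter.Eventually.of_forall fun x => ?_)
    simp only [Function.comp, add_sub_cancel]
  · have h := hasDerivAt_contactEntropy₂_dir h1 h2 h3 0 1
    simp only [mul_one, mul_zero, add_zero, zero_mul, one_mul, neg_zero, zero_sub] at h
    have hsub : HasDerivAt (fun x : ℝ => x - a') 1 a' := (hasDerivAt_id a').sub_const a'
    have hc := HasDerivAt.comp (h₂ := fun θ : ℝ => contactEntropy₂ a (a' + θ)) (h := fun x : ℝ => x - a') a'
      (by rw [sub_self]; exact h) hsub
    rw [mul_one] at hc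
    refine hc.congr_of_eventuallyEq (Filter.Eventually.of_forall fun x => ?_)
    simp only [Function.comp, add_sub_cancel]

/-! ## §3 (ed.2) The gradient of the joint rate in density coordinates and its unique critical point -/

variable {y z : ℝ}

/-- ★★ **The joint rate in density coordinates is differentiable along every line, with gradient the LOG-TILT**: for a base `y, z > 0`,
`(a,a')` in the open triangle and a direction `(d₁,d₂)`, `θ ↦ J(y,z; Y(a+θd₁,a'+θd₂), Y(a'+θd₂,a+θd₁))` has derivative
`d₁·log(Y(a,a')/y) + d₂·log(Y(a',a)/z)` at `θ = 0` (Gibbs form `J̃ = log μ_1(y,z) − a log y − a' log z − s(a,a')` and §2).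
[cite: DemboZeitouni2010, §2.2 Theorem 2.2.3 (Cramér: the rate function's derivative is the dual parameter); JansevanRensburg2000, §3.2 Theorem 3.19 (1st ed., p. 52)] -/
theorem hasDerivAt_jointRate_eosY_dir (hy : 0 < y) (hz : 0 < z) {a a' : ℝ} (h1 : a + a' < 1 / 2) (h2 : 1 < 4 * a + 2 * a')
    (h3 : 1 < 2 * a + 4 * a') (d₁ d₂ : ℝ) :
    HasDerivAt (fun θ : ℝ => jointRate y z (eosY (a + θ * d₁) (a' + θ * d₂)) (eosY (a' + θ * d₂) (a + θ * d₁)))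
      (d₁ * Real.log (eosY a a' / y) + d₂ * Real.log (eosY a' a / z)) 0 := by
  obtain ⟨hY0, hZ0, -, -, -, -⟩ := contactB_eosY h1 h2 h3
  have hs := hasDerivAt_contactEntropy₂_dir h1 h2 h3 d₁ d₂
  -- the Gibbs form holds near `θ = 0`
  have hT : ∀ᶠ θ : ℝ in 𝓝 0, (a + θ * d₁) + (a' + θ * d₂) < 1 / 2 ∧ 1 < 4 * (a + θ * d₁) + 2 * (a' + θ * d₂) ∧
      1 < 2 * (a + θ * d₁) + 4 * (a' + θ * d₂) := by
    have c1 : ContinuousAt (fun θ : ℝ => (a + θ * d₁) + (a' + θ * d₂)) 0 :=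
      (continuousAt_const.add (continuousAt_id.mul continuousAt_const)).add
        (continuousAt_const.add (continuousAt_id.mul continuousAt_const))
    have c2 : ContinuousAt (fun θ : ℝ => 4 * (a + θ * d₁) + 2 * (a' + θ * d₂)) 0 :=
      (continuousAt_const.mul (continuousAt_const.add (continuousAt_id.mul continuousAt_const))).add
        (continuousAt_const.mul (continuousAt_const.add (continuousAt_id.mul continuousAt_const)))
    have c3 : ContinuousAt (fun θ : ℝ => 2 * (a + θ * d₁) + 4 * (a' + θ * d₂)) 0 :=
      (continuousAt_const.mul (continuousAt_const.add (continuousAt_id.mul continuousAt_const))).add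
        (continuousAt_const.mul (continuousAt_const.add (continuousAt_id.mul continuousAt_const)))
    have e1 := c1.eventually_lt continuousAt_const (by simp only [zero_mul, add_zero]; exact h1)
    have e2 := (continuousAt_const).eventually_lt c2 (by simp only [zero_mul, add_zero]; exact h2)
    have e3 := (continuousAt_const).eventually_lt c3 (by simp only [zero_mul, add_zero]; exact h3)
    filter_upwards [e1, e2, e3] with θ t1 t2 t3 using ⟨t1, t2, t3⟩
  have hlin : HasDerivAt (fun θ : ℝ => Real.log (stripMuY₂ 1 y z) -
      ((a + θ * d₁) * Real.log y + (a' + θ * d₂) * Real.log z + contactEntropy₂ (a + θ * d₁) (a' + θ * d₂)))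
      (0 - ((0 + 1 * d₁) * Real.log y + (0 + 1 * d₂) * Real.log z +
        (-(d₁ * Real.log (eosY a a')) - d₂ * Real.log (eosY a' a)))) 0 := by
    refine (hasDerivAt_const 0 _).sub ((((hasDerivAt_const 0 a).add ((hasDerivAt_id 0).mul_const d₁)).mul_const _).add
      (((hasDerivAt_const 0 a').add ((hasDerivAt_id 0).mul_const d₂)).mul_const _) |>.add hs)
  have e : 0 - ((0 + 1 * d₁) * Real.log y + (0 + 1 * d₂) * Real.log z + (-(d₁ * Real.log (eosY a a')) - d₂ * Real.log (eosY a' a))) =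
      d₁ * Real.log (eosY a a' / y) + d₂ * Real.log (eosY a' a / z) := by
    rw [Real.log_div hY0.ne' hy.ne', Real.log_div hZ0.ne' hz.ne']; ring
  rw [e] at hlin
  refine hlin.congr_of_eventuallyEq ?_
  filter_upwards [hT] with θ hθ
  rw [jointRate_eq_sub_contactEntropy₂ hy hz hθ.1 hθ.2.1 hθ.2.2]

/-- ★★ **The unique critical point of the joint rate is the typical density pair**: the gradient
`(log(Y(a,a')/y), log(Y(a',a)/z))` of `J̃_{y,z}` vanishes iff `(a,a') = (b(y,z), b(z,y))` (injectivity of the wall chart).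
[cite: DemboZeitouni2010, §2.2 Theorem 2.2.3; BeatonBousquetMelouDeGierDuminilCopinGuttmann2014, §3.2 Proposition 6 (arXiv v5 p. 10)] -/
theorem jointRate_gradient_eq_zero_iff (hy : 0 < y) (hz : 0 < z) {a a' : ℝ} (h1 : a + a' < 1 / 2) (h2 : 1 < 4 * a + 2 * a')
    (h3 : 1 < 2 * a + 4 * a') :
    (Real.log (eosY a a' / y) = 0 ∧ Real.log (eosY a' a / z) = 0) ↔ (a = contactB y z ∧ a' = contactB z y) := by
  obtain ⟨hY0, hZ0, hb, hb', -, -⟩ := contactB_eosY h1 h2 h3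
  constructor
  · rintro ⟨e1, e2⟩
    have hY : eosY a a' = y := by
      have := Real.exp_log (div_pos hY0 hy)
      rw [e1, Real.exp_zero] at this
      field_simp at this; linarith
    have hZ : eosY a' a = z := by
      have := Real.exp_log (div_pos hZ0 hz)
      rw [e2, Real.exp_zero] at this
      field_simp at this; linarith
    rw [hY, hZ] at hb hb'
    exact ⟨hb.symm, hb'.symm⟩
  · rintro ⟨e1, e2⟩
    obtain ⟨eY, eZ⟩ := eosY_contactB hy hz
    rw [e1, e2, eY, eZ, div_self hy.ne', div_self hz.ne', Real.log_one]
    exact ⟨rfl, rfl⟩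

end Literature.Probability.RandomPlanarGeometry.SAW.HexBW
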